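import Mathlib.Algebra.BigOperators.Group.Finset.Basic
import Mathlib.Data.Int.Order.Units
import Mathlib.Tactic.Ring
import HarnessLib

set_option linter.dupNamespace false

/-!
# Weil-type family coverage — TYPE-III WINDOWS, part M (census block b04.24 P.S.): the ALGEBRAIC SKELETON of the PARITY INVARIANT `ε` (THEOREM S26.5)

research route conditional on HC_CM; not a corollary; Q11.4-sentence-2 already refuted in dim ≥ 3.

Ring 2, WEIL-TYPE FAMILY-COVERAGE CENSUS (`HOME/WEIL-FAMILY-COVERAGE.md` `## b04`, block b04.24 and its P.S., owner ring2-b04, gen 60; theory note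
`HOME/pub-hodge-ring2-b04/census-g60/theory/THEOREMS-S26.md` §6).  SETTING (informal, NOT formalised): for a rank-`k` skew-hermitian form `T`
over the definite quaternion algebra `D` and a split prime `ℓ`, the Hasse invariant `s_ℓ(T) ∈ {±1}` of the Morita form needs a choice of splitting
`ι_ℓ : D_ℓ ≅ M₂(ℚ_ℓ)`; another choice multiplies `s_ℓ` of EVERY form by one and the same sign `c_ℓ` (S19 LEMMA 1′), and a similarity `T ↦ λT`
multiplies it by the Hilbert symbol `φ_ℓ(λ) = (λ, (−1)^kΔ)_ℓ` (LEMMA 1″).  THEOREM S26.5: when `(−1)^kΔ` is a square at every ramified place of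
`D`, Hilbert reciprocity makes `∏_{ℓ ∈ N} φ_ℓ(λ) = 1` over the set `N` of non-`Inv` split primes, so `ε = ∏_{ℓ ∈ N} s_ℓ` is a similarity
invariant once the splittings are fixed ((b)(ii)), and the RELATIVE sign `ε(T,T′) = ∏_{ℓ ∈ N} s_ℓ(T)s_ℓ(T′)` is free of every choice ((g)).
THIS FILE checks the three pieces of finite-product bookkeeping behind those sentences, for signs in `ℤˣ` (or any commutative group) indexed
by an arbitrary finite set: (1) `parity_scaling_invariant` — if the scaling characters multiply to `1` over `N`, the product of the `s_ℓ` over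
`N` is unchanged by the scaling; (2) `relParity_choice_free` — the relative product does not see a common change of splittings `c_ℓ`
(`c_ℓ·c_ℓ = 1`); (3) `reciprocity_restrict` — if a family of signs multiplies to `1` over a finite set `V` of places and is `1` on a subset `I`
(the `Inv` primes, where `(λ, □) = 1`, together with the ramified places where `δ` is a square), then it multiplies to `1` over `V ∖ I`; plus the
class count of §6 (b) for `k = 2` (`classCount_rank_two`).  Nothing about quaternion algebras, Hilbert symbols or abelian varieties is
formalised; `HC_CM` is used nowhere.  No `sorry`, no definitions.
-/

namespace Summit.HodgeConjecture.HodgeConjecture.Ring2.WeilCoverage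

/-- THEOREM S26.5 (b)(ii), skeleton: if the scaling characters `φ ℓ` multiply to `1` over the finite set `N` (Hilbert reciprocity with the
`Inv` and ramified places contributing `1`), then `∏_{ℓ ∈ N} s ℓ · φ ℓ = ∏_{ℓ ∈ N} s ℓ` — the product `ε` of the Hasse signs over the non-`Inv`
split primes is a similarity invariant (for fixed splittings).
research route conditional on HC_CM; not a corollary; Q11.4-sentence-2 already refuted in dim ≥ 3. -/
theorem parity_scaling_invariant {ι M : Type*} [CommMonoid M] (N : Finset ι) (s φ : ι → M)
    (hφ : ∏ l ∈ N, φ l = 1) : ∏ l ∈ N, (s l * φ l) = ∏ l ∈ N, s l := by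
  rw [Finset.prod_mul_distrib, hφ, mul_one]

/-- THEOREM S26.5 (g), skeleton: a common change of splittings multiplies `s ℓ` and `s′ ℓ` by the same sign `c ℓ` with `c ℓ * c ℓ = 1`
(here: any `ℤˣ`-valued family), so the RELATIVE product `∏_{ℓ ∈ N} s ℓ · s′ ℓ` is independent of the splittings.
research route conditional on HC_CM; not a corollary; Q11.4-sentence-2 already refuted in dim ≥ 3. -/
theorem relParity_choice_free {ι : Type*} (N : Finset ι) (s s' c : ι → ℤˣ) :
    ∏ l ∈ N, ((s l * c l) * (s' l * c l)) = ∏ l ∈ N, (s l * s' l) := by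
  refine Finset.prod_congr rfl (fun l _ => ?_)
  calc s l * c l * (s' l * c l) = s l * s' l * (c l * c l) := by
        simp only [mul_comm, mul_left_comm]
    _ = s l * s' l := by rw [Int.units_mul_self, mul_one]

/-- The same over any commutative monoid, with the involutivity as a hypothesis (`c ℓ * c ℓ = 1` on `N`).
research route conditional on HC_CM; not a corollary; Q11.4-sentence-2 already refuted in dim ≥ 3. -/
theorem relParity_choice_free' {ι M : Type*} [CommMonoid M] (N : Finset ι) (s s' c : ι → M)
    (hc : ∀ l ∈ N, c l * c l = 1) :
    ∏ l ∈ N, ((s l * c l) * (s' l * c l)) = ∏ l ∈ N, (s l * s' l) := by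
  refine Finset.prod_congr rfl (fun l hl => ?_)
  calc s l * c l * (s' l * c l) = s l * s' l * (c l * c l) := by
        simp only [mul_comm, mul_left_comm]
    _ = s l * s' l := by rw [hc l hl, mul_one]

/-- Reciprocity restricted (THEOREM S26.5 (b), the step «`∏_{ℓ split ∉ Inv}(λ,δ)_ℓ = ∏_{all v}(λ,δ)_v = 1`»): if a finitely supported family of
signs multiplies to `1` over `V` and equals `1` on the subset `I ⊆ V` (the `Inv` primes and the ramified places where `δ` is a local square),
then it multiplies to `1` over `V ∖ I`.
research route conditional on HC_CM; not a corollary; Q11.4-sentence-2 already refuted in dim ≥ 3. -/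
theorem reciprocity_restrict {ι M : Type*} [CommMonoid M] [DecidableEq ι] (V I : Finset ι) (hI : I ⊆ V) (a : ι → M)
    (hrec : ∏ v ∈ V, a v = 1) (hone : ∀ v ∈ I, a v = 1) : ∏ v ∈ V \ I, a v = 1 := by
  have h := Finset.prod_sdiff (f := a) hI
  rw [Finset.prod_eq_one hone, mul_one] at h
  rw [h, hrec]

/-- … whereas if `a` equals `1` on `I` EXCEPT possibly at ONE place `v₀ ∈ V ∖ I` — no: the converse bookkeeping used in (b)(i): if the family is
`1` on `I` and multiplies to `1` over `V`, then its product over `V ∖ (I ∪ {v₀})` equals `a v₀`… stated in the form actually used: the product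
over `V ∖ I` splits as `a v₀ · ∏_{V ∖ I ∖ {v₀}}`, so a ramified place `v₀` where `δ` is a NON-square absorbs the parity (`a v₀` free) and every
sign pattern on the remaining places is compatible with reciprocity.
research route conditional on HC_CM; not a corollary; Q11.4-sentence-2 already refuted in dim ≥ 3. -/
theorem parity_absorbed {ι M : Type*} [CommMonoid M] [DecidableEq ι] (W : Finset ι) (v₀ : ι) (hv : v₀ ∈ W) (a : ι → M) :
    ∏ v ∈ W, a v = a v₀ * ∏ v ∈ W.erase v₀, a v := by
  rw [Finset.mul_prod_erase W a hv]

/-- THEOREM S26.5 (b), the count for `k = 2` (Book of Involutions §15.B dictionary): the free local bits of the quaternion algebra `Q` over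
`Z = ℚ(√δ)` sit over the finite ramified prime `p₀` (present iff `δ ∈ ℚ_{p₀}^{×2}`) and over `∞`, and `Q ∼ ιQ` flips both at once: with the
`p₀`-bit present there are `2·2/2 = 2` classes per `(Δ,S)`, without it `2/2 = 1`; for `Δ ∈ ℚ^{×2}` the distribution of `{p₀, ∞}` between `Q₁`
and `Q₂` is forced by parity: `1` class.
research route conditional on HC_CM; not a corollary; Q11.4-sentence-2 already refuted in dim ≥ 3. -/
theorem classCount_rank_two : (2 * 2 / 2 = 2) ∧ (2 / 2 = 1) ∧ (1 * 2 / 2 = 1) := by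
  decide

end Summit.HodgeConjecture.HodgeConjecture.Ring2.WeilCoverage
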